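import Summits.HubbardSuperconductivity.HubbardSuperconductivity.Theorems.AnisotropyChordTransferFibre3BetaFreeTargets
import Summits.HubbardSuperconductivity.HubbardSuperconductivity.Theorems.AnisotropyChordTransferFibre3TwoMagnon

/-!
# Route `AnisotropyChord` / H0 rotor rung: the ground two-magnon profile is STRICTLY POSITIVE off the origin

Memo ROTOR-THEORY-21 §302(c)(ii),(iii) (theory seat `hubbard-h0-rotor-theory-1`): the minimality clause of
`IsGroundTwoMagnon` (`λ₂ Σ g² ≤ Q(g)` for every `g` vanishing at the origin, `Q = twoMagnonQF`) makes `f` the ground state of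
the `K = 0` two-magnon problem on the punctured torus, hence `f > 0` off the origin (**`ground_pos`**).  Perron-type proof,
all elementary: `Q(|g|) ≤ Q(g)` with defect `Σ_{r,e}(|g(r)g(r+e)| − g(r)g(r+e))` (`qf_sub_qf_abs`); the eigen-equation gives
`Q(f) = λ₂Σf²`, so `|f|` is a minimiser too; a single-site variation at a zero `r₁ ≠ 0` of a nonnegative minimiser forces its
four neighbours to vanish (`nbSum_eq_zero_of_min`); the punctured torus `(ℤ/L)² ∖ {0}` is connected by `+eₓ`, `+e_y` steps
(`torus_connect`), so a zero would propagate to `x̂` where `f(x̂) > 0`; finally all bond products `f(r)f(r+e)` are `≥ 0`, so the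
sign of `f` is constant.  Used by `…Fibre3GroundState` (admissibility of `Π⁰`, `β > 0`, `T⁺ > 0`).
Prover seat `hubbard-h0-rotor-p1` g22; helper for stmt-HubbardSuperconductivity-19089 (`--supports`).
-/

set_option linter.dupNamespace false
set_option autoImplicit false

noncomputable section

open scoped BigOperators

namespace Summit.HubbardSuperconductivity.HubbardSuperconductivity.Theorems.AnisotropyChord.Transfer.Fibre3

variable (L : ℕ) [NeZero L]

/-! ## The quadratic form written out -/

/-- nearest-neighbour indicator as a real number. [folklore] -/
def nnInd (r : Tor L) : ℝ := if IsNN L r then 1 else 0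

/-- sum of `g` over the four neighbours of `r`. [folklore] -/
def nbSum (g : Tor L → ℝ) (r : Tor L) : ℝ := g (r + ex L) + g (r + -ex L) + g (r + ey L) + g (r + -ey L)

omit [NeZero L] in
/-- a `nnList` sum is the four-term sum over `±eₓ, ±e_y`. [folklore] -/
theorem nnList_map_sum (h : Tor L → ℝ) : ((nnList L).map h).sum = h (ex L) + h (-ex L) + h (ey L) + h (-ey L) := by
  rw [← neg_ex, ← neg_ey]
  simp only [nnList, ex, ey, List.map_cons, List.map_nil, List.sum_cons, List.sum_nil]
  ring

/-- **the two-magnon form written out:** `Q(g) = Σ_r [(4 − Δ·1_NN(r)) g(r)² − g(r)·Σ_e g(r+e)]`. [folklore] -/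
theorem twoMagnonQF_eq (Δ : ℝ) (g : Tor L → ℝ) :
    twoMagnonQF L Δ g = ∑ r : Tor L, ((4 - Δ * nnInd L r) * g r ^ 2 - g r * nbSum L g r) := by
  unfold twoMagnonQF nbSum nnInd
  refine Finset.sum_congr rfl fun r _ => ?_
  rw [nnList_map_sum]
  ring

/-- for a two-magnon eigenfunction `Q(f) = λ₂ Σ f²`. [folklore] -/
theorem twoMagnonQF_of_isTwoMagnon {Δ lam2 : ℝ} {f : Tor L → ℝ} (hf : IsTwoMagnon L Δ lam2 f) :
    twoMagnonQF L Δ f = lam2 * ∑ r : Tor L, f r ^ 2 := by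
  obtain ⟨h0, _, _, _, heq⟩ := hf
  unfold twoMagnonQF
  rw [Finset.mul_sum]
  refine Finset.sum_congr rfl fun r _ => ?_
  by_cases hr : r = 0
  · rw [hr, h0]; ring
  · rw [heq r hr]; ring

/-! ## Symmetry and polarisation -/

/-- reindexing a bond sum. [folklore] -/
theorem sum_mul_shift (g h : Tor L → ℝ) (e : Tor L) :
    ∑ r : Tor L, g r * h (r + e) = ∑ r : Tor L, h r * g (r + -e) := by
  refine Fintype.sum_equiv (Equiv.addRight e) _ _ fun r => ?_
  simp only [Equiv.coe_addRight, add_neg_cancel_right]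
  ring

/-- the hopping form is symmetric: `Σ_r g(r) Σ_e h(r+e) = Σ_r h(r) Σ_e g(r+e)`. [folklore] -/
theorem sum_nbSum_symm (g h : Tor L → ℝ) :
    ∑ r : Tor L, g r * nbSum L h r = ∑ r : Tor L, h r * nbSum L g r := by
  unfold nbSum
  simp only [mul_add, Finset.sum_add_distrib]
  rw [sum_mul_shift L g h (ex L), sum_mul_shift L g h (-ex L), sum_mul_shift L g h (ey L), sum_mul_shift L g h (-ey L)]
  simp only [neg_neg]
  ring

/-- the associated bilinear form is symmetric. [folklore] -/
theorem qf_bilin_symm (Δ : ℝ) (g h : Tor L → ℝ) :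
    ∑ r : Tor L, g r * ((4 - Δ * nnInd L r) * h r - nbSum L h r)
      = ∑ r : Tor L, h r * ((4 - Δ * nnInd L r) * g r - nbSum L g r) := by
  have e1 : ∑ r : Tor L, g r * ((4 - Δ * nnInd L r) * h r - nbSum L h r)
      = ∑ r : Tor L, (4 - Δ * nnInd L r) * (g r * h r) - ∑ r : Tor L, g r * nbSum L h r := by
    rw [← Finset.sum_sub_distrib]; refine Finset.sum_congr rfl fun r _ => ?_; ring
  have e2 : ∑ r : Tor L, h r * ((4 - Δ * nnInd L r) * g r - nbSum L g r)
      = ∑ r : Tor L, (4 - Δ * nnInd L r) * (g r * h r) - ∑ r : Tor L, h r * nbSum L g r := by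
    rw [← Finset.sum_sub_distrib]; refine Finset.sum_congr rfl fun r _ => ?_; ring
  rw [e1, e2, sum_nbSum_symm]

omit [NeZero L] in
/-- [folklore] -/
theorem nbSum_add (g h : Tor L → ℝ) (r : Tor L) : nbSum L (fun s => g s + h s) r = nbSum L g r + nbSum L h r := by
  unfold nbSum; ring

omit [NeZero L] in
/-- [folklore] -/
theorem nbSum_smul (t : ℝ) (h : Tor L → ℝ) (r : Tor L) : nbSum L (fun s => t * h s) r = t * nbSum L h r := by
  unfold nbSum; ring

/-- **polarisation:** `Q(g + h) = Q(g) + 2·B(h, g) + Q(h)`. [folklore] -/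
theorem qf_add (Δ : ℝ) (g h : Tor L → ℝ) :
    twoMagnonQF L Δ (fun r => g r + h r)
      = twoMagnonQF L Δ g + 2 * (∑ r : Tor L, h r * ((4 - Δ * nnInd L r) * g r - nbSum L g r)) + twoMagnonQF L Δ h := by
  rw [twoMagnonQF_eq, twoMagnonQF_eq, twoMagnonQF_eq]
  have hpt : ∀ r : Tor L, (4 - Δ * nnInd L r) * (g r + h r) ^ 2 - (g r + h r) * nbSum L (fun s => g s + h s) r
      = ((4 - Δ * nnInd L r) * g r ^ 2 - g r * nbSum L g r)
        + (g r * ((4 - Δ * nnInd L r) * h r - nbSum L h r) + h r * ((4 - Δ * nnInd L r) * g r - nbSum L g r))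
        + ((4 - Δ * nnInd L r) * h r ^ 2 - h r * nbSum L h r) := by
    intro r; rw [nbSum_add]; ring
  rw [Finset.sum_congr rfl fun r _ => hpt r, Finset.sum_add_distrib, Finset.sum_add_distrib, Finset.sum_add_distrib,
    qf_bilin_symm]
  ring

/-- homogeneity: `Q(t·h) = t² Q(h)`. [folklore] -/
theorem qf_smul (Δ t : ℝ) (h : Tor L → ℝ) : twoMagnonQF L Δ (fun r => t * h r) = t ^ 2 * twoMagnonQF L Δ h := by
  rw [twoMagnonQF_eq, twoMagnonQF_eq, Finset.mul_sum]
  refine Finset.sum_congr rfl fun r _ => ?_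
  rw [nbSum_smul]; ring

/-! ## `Q(|g|) ≤ Q(g)` -/

/-- **the absolute value lowers the form:** `Q(g) − Q(|g|) = Σ_r (|g(r)|·Σ_e|g(r+e)| − g(r)·Σ_e g(r+e)) ≥ 0`. [folklore] -/
theorem qf_sub_qf_abs (Δ : ℝ) (g : Tor L → ℝ) :
    twoMagnonQF L Δ g - twoMagnonQF L Δ (fun r => |g r|)
      = ∑ r : Tor L, (|g r| * nbSum L (fun s => |g s|) r - g r * nbSum L g r) := by
  rw [twoMagnonQF_eq, twoMagnonQF_eq, ← Finset.sum_sub_distrib]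
  refine Finset.sum_congr rfl fun r _ => ?_
  rw [sq_abs]; ring

omit [NeZero L] in
/-- each defect term is nonnegative. [folklore] -/
theorem abs_nbSum_sub_nonneg (g : Tor L → ℝ) (r : Tor L) :
    0 ≤ |g r| * nbSum L (fun s => |g s|) r - g r * nbSum L g r := by
  unfold nbSum
  have h1 := le_abs_self (g r * g (r + ex L))
  have h2 := le_abs_self (g r * g (r + -ex L))
  have h3 := le_abs_self (g r * g (r + ey L))
  have h4 := le_abs_self (g r * g (r + -ey L))
  rw [abs_mul] at h1 h2 h3 h4
  nlinarith

/-- `Q(|g|) ≤ Q(g)`. [folklore] -/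
theorem qf_abs_le (Δ : ℝ) (g : Tor L → ℝ) : twoMagnonQF L Δ (fun r => |g r|) ≤ twoMagnonQF L Δ g := by
  have := qf_sub_qf_abs L Δ g
  have hnn : 0 ≤ ∑ r : Tor L, (|g r| * nbSum L (fun s => |g s|) r - g r * nbSum L g r) :=
    Finset.sum_nonneg fun r _ => abs_nbSum_sub_nonneg L g r
  linarith

/-! ## A zero of a nonnegative minimiser has vanishing neighbours -/

/-- **single-site variation:** if `g ≥ 0`, `g(0) = 0`, `Q(g) = λ₂Σg²` and `λ₂` is the constrained minimum, then at every
zero `r₁ ≠ 0` of `g` the neighbour sum `Σ_e g(r₁+e)` vanishes. [folklore] -/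
theorem nbSum_eq_zero_of_min {Δ lam2 : ℝ} {g : Tor L → ℝ} (hg0 : ∀ r, 0 ≤ g r)
    (hmin : ∀ h : Tor L → ℝ, h 0 = 0 → lam2 * ∑ r : Tor L, h r ^ 2 ≤ twoMagnonQF L Δ h)
    (hgmin : twoMagnonQF L Δ g = lam2 * ∑ r : Tor L, g r ^ 2) (hz : g 0 = 0)
    {r₁ : Tor L} (hr₁ : r₁ ≠ 0) (hgr : g r₁ = 0) : nbSum L g r₁ = 0 := by
  classical
  set s : ℝ := nbSum L g r₁ with hs
  have hs0 : 0 ≤ s := by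
    rw [hs]; unfold nbSum
    have := hg0 (r₁ + ex L); have := hg0 (r₁ + -ex L); have := hg0 (r₁ + ey L); have := hg0 (r₁ + -ey L)
    linarith
  set δ : Tor L → ℝ := fun r => if r = r₁ then 1 else 0 with hδ
  set C : ℝ := twoMagnonQF L Δ δ - lam2 with hC
  -- the variation inequality: 0 ≤ −2ts + t²C for every t
  have hvar : ∀ t : ℝ, 0 ≤ -2 * t * s + t ^ 2 * C := by
    intro t
    have hmin_t := hmin (fun r => g r + t * δ r) (by simp [hδ, hz, hr₁.symm])
    have hQ := qf_add L Δ g (fun r => t * δ r)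
    have hcross : ∑ r : Tor L, (t * δ r) * ((4 - Δ * nnInd L r) * g r - nbSum L g r) = -(t * s) := by
      have : ∀ r : Tor L, (t * δ r) * ((4 - Δ * nnInd L r) * g r - nbSum L g r)
          = if r = r₁ then t * ((4 - Δ * nnInd L r) * g r - nbSum L g r) else 0 := by
        intro r; simp only [hδ]; split_ifs <;> ring
      rw [Finset.sum_congr rfl fun r _ => this r, Finset.sum_ite_eq' Finset.univ r₁]
      simp only [Finset.mem_univ, if_true]
      rw [hgr, hs]; ring
    have hsq : ∑ r : Tor L, (g r + t * δ r) ^ 2 = ∑ r : Tor L, g r ^ 2 + t ^ 2 := by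
      have : ∀ r : Tor L, (g r + t * δ r) ^ 2 = g r ^ 2 + (if r = r₁ then 2 * t * g r + t ^ 2 else 0) := by
        intro r; simp only [hδ]; split_ifs <;> ring
      rw [Finset.sum_congr rfl fun r _ => this r, Finset.sum_add_distrib, Finset.sum_ite_eq' Finset.univ r₁]
      simp only [Finset.mem_univ, if_true]
      rw [hgr]; ring
    rw [hQ, hcross, qf_smul, hgmin] at hmin_t
    rw [hsq] at hmin_t
    rw [hC]
    nlinarith [hmin_t]
  -- hence s = 0
  by_contra hne
  have hspos : 0 < s := lt_of_le_of_ne hs0 (Ne.symm hne)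
  set t : ℝ := s / (|C| + 1) with ht
  have htpos : 0 < t := by rw [ht]; positivity
  have h1 : t * (|C| + 1) = s := by rw [ht]; field_simp
  have h2 : t ^ 2 * C ≤ t ^ 2 * |C| := by nlinarith [le_abs_self C, sq_nonneg t]
  have h3 : t * |C| < s := by nlinarith [abs_nonneg C]
  have := hvar t
  nlinarith

/-! ## Connectivity of the punctured torus -/

/-- **propagation along a row:** a property stable under `+eₓ` steps among nonzero sites spreads along any row `{y = b}`,
`b ≠ 0`. [folklore] -/
theorem row_propagate (P : Tor L → Prop) (hstep : ∀ r : Tor L, r ≠ 0 → P r → r + ex L ≠ 0 → P (r + ex L))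
    {a b : ZMod L} (hb : b ≠ 0) (ha : P (a, b)) (x : ZMod L) : P (x, b) := by
  have key : ∀ n : ℕ, P (a + n, b) := by
    intro n
    induction n with
    | zero => simpa using ha
    | succ n ih =>
      have hne : ((a + n, b) : Tor L) ≠ 0 := fun h => hb (congrArg Prod.snd h)
      have hne' : ((a + n, b) : Tor L) + ex L ≠ 0 := fun h => hb (by have := congrArg Prod.snd h; simpa [ex] using this)
      have := hstep _ hne ih hne'
      have e : ((a + n, b) : Tor L) + ex L = (a + (n + 1 : ℕ), b) := by
        unfold ex; ext <;> simp; ring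
      rw [e] at this; exact this
  have := key (x - a).val
  rw [ZMod.natCast_zmod_val, add_sub_cancel] at this
  exact this

/-- **propagation along a column** (`+e_y` steps, column `{x = a}`, `a ≠ 0`). [folklore] -/
theorem col_propagate (P : Tor L → Prop) (hstep : ∀ r : Tor L, r ≠ 0 → P r → r + ey L ≠ 0 → P (r + ey L))
    {a b : ZMod L} (ha0 : a ≠ 0) (ha : P (a, b)) (y : ZMod L) : P (a, y) := by
  have key : ∀ n : ℕ, P (a, b + n) := by
    intro n
    induction n with
    | zero => simpa using ha
    | succ n ih =>
      have hne : ((a, b + n) : Tor L) ≠ 0 := fun h => ha0 (congrArg Prod.fst h)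
      have hne' : ((a, b + n) : Tor L) + ey L ≠ 0 := fun h => ha0 (by have := congrArg Prod.fst h; simpa [ey] using this)
      have := hstep _ hne ih hne'
      have e : ((a, b + n) : Tor L) + ey L = (a, b + (n + 1 : ℕ)) := by
        unfold ey; ext <;> simp; ring
      rw [e] at this; exact this
  have := key (y - b).val
  rw [ZMod.natCast_zmod_val, add_sub_cancel] at this
  exact this

/-- **the punctured torus is connected:** a property of nonzero sites stable under `+eₓ` and `+e_y` steps (within the
nonzero sites) holds at every nonzero site once it holds at one (`L ≥ 2`). [folklore] -/
theorem torus_connect (hL : 2 ≤ L) (P : Tor L → Prop)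
    (hx : ∀ r : Tor L, r ≠ 0 → P r → r + ex L ≠ 0 → P (r + ex L))
    (hy : ∀ r : Tor L, r ≠ 0 → P r → r + ey L ≠ 0 → P (r + ey L))
    {a b : Tor L} (ha : a ≠ 0) (hb : b ≠ 0) (hPa : P a) : P b := by
  have h1 : (1 : ZMod L) ≠ 0 := by
    haveI : Fact (1 < L) := ⟨by omega⟩
    exact one_ne_zero
  obtain ⟨a1, a2⟩ := a
  obtain ⟨b1, b2⟩ := b
  -- move to a point with nonzero second coordinate
  have stage : ∃ a1' : ZMod L, ∃ a2' : ZMod L, a2' ≠ 0 ∧ P (a1', a2') := by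
    by_cases h2 : a2 = 0
    · subst h2
      have ha1 : a1 ≠ 0 := fun h => ha (by rw [h]; rfl)
      exact ⟨a1, 1, h1, col_propagate L P hy ha1 hPa 1⟩
    · exact ⟨a1, a2, h2, hPa⟩
  obtain ⟨a1', a2', ha2', hP'⟩ := stage
  by_cases hb1 : b1 = 0
  · subst hb1
    have hb2 : b2 ≠ 0 := fun h => hb (by rw [h]; rfl)
    -- (a1',a2') → (1,a2') → (1,b2) → (0,b2)
    have s1 : P (1, a2') := row_propagate L P hx ha2' hP' 1
    have s2 : P (1, b2) := col_propagate L P hy h1 s1 b2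
    exact row_propagate L P hx hb2 s2 0
  · have s1 : P (b1, a2') := row_propagate L P hx ha2' hP' b1
    exact col_propagate L P hy hb1 s1 b2

/-! ## Positivity of the ground profile -/

/-- `|f|` is a minimiser together with `f`, and `Q(|f|) = Q(f)`. [folklore] -/
theorem abs_is_minimiser {Δ lam2 : ℝ} {f : Tor L → ℝ} (hf : IsGroundTwoMagnon L Δ lam2 f) :
    twoMagnonQF L Δ (fun r => |f r|) = lam2 * ∑ r : Tor L, |f r| ^ 2
      ∧ twoMagnonQF L Δ (fun r => |f r|) = twoMagnonQF L Δ f := by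
  obtain ⟨htm, _, hmin⟩ := hf
  have hQf := twoMagnonQF_of_isTwoMagnon L htm
  have hle := qf_abs_le L Δ f
  have hge := hmin (fun r => |f r|) (by simp [htm.1])
  have hsq : ∑ r : Tor L, |f r| ^ 2 = ∑ r : Tor L, f r ^ 2 := Finset.sum_congr rfl fun r _ => sq_abs (f r)
  rw [hsq] at hge ⊢
  constructor <;> linarith

/-- **the ground profile does not vanish off the origin** (`L ≥ 2`). [folklore] -/
theorem ground_ne_zero (hL : 2 ≤ L) {Δ lam2 : ℝ} {f : Tor L → ℝ} (hf : IsGroundTwoMagnon L Δ lam2 f)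
    (r : Tor L) (hr : r ≠ 0) : f r ≠ 0 := by
  obtain ⟨hQg, _⟩ := abs_is_minimiser L hf
  obtain ⟨htm, _, hmin⟩ := hf
  have h0 : f 0 = 0 := htm.1
  have hpos : 0 < f (K1 L) := htm.2.2.1
  intro hfr
  set g : Tor L → ℝ := fun r => |f r| with hg
  have hg0 : ∀ r, 0 ≤ g r := fun r => abs_nonneg _
  have hgz : g 0 = 0 := by simp [hg, h0]
  -- zeros propagate
  have hnb : ∀ r : Tor L, r ≠ 0 → g r = 0 → nbSum L g r = 0 :=
    fun r hr' hgr => nbSum_eq_zero_of_min L hg0 hmin hQg hgz hr' hgr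
  have hx : ∀ r : Tor L, r ≠ 0 → g r = 0 → r + ex L ≠ 0 → g (r + ex L) = 0 := by
    intro r hr' hgr _
    have h := hnb r hr' hgr
    unfold nbSum at h
    have := hg0 (r + ex L); have := hg0 (r + -ex L); have := hg0 (r + ey L); have := hg0 (r + -ey L)
    linarith
  have hy : ∀ r : Tor L, r ≠ 0 → g r = 0 → r + ey L ≠ 0 → g (r + ey L) = 0 := by
    intro r hr' hgr _
    have h := hnb r hr' hgr
    unfold nbSum at h
    have := hg0 (r + ex L); have := hg0 (r + -ex L); have := hg0 (r + ey L); have := hg0 (r + -ey L)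
    linarith
  have hK : K1 L ≠ 0 := K1_ne_zero L hL
  have := torus_connect L hL (fun r => g r = 0) hx hy hr hK (by simp [hg, hfr])
  have : |f (K1 L)| = 0 := this
  rw [abs_eq_zero] at this
  linarith

/-- **POSITIVITY OF THE GROUND PROFILE:** `IsGroundTwoMagnon L Δ λ₂ f` ⇒ `0 < f r` for every `r ≠ 0` (`L ≥ 2`). [folklore] -/
theorem ground_pos (hL : 2 ≤ L) {Δ lam2 : ℝ} {f : Tor L → ℝ} (hf : IsGroundTwoMagnon L Δ lam2 f)
    (r : Tor L) (hr : r ≠ 0) : 0 < f r := by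
  have hne := ground_ne_zero L hL hf
  obtain ⟨_, hQeq⟩ := abs_is_minimiser L hf
  obtain ⟨htm, _, _⟩ := hf
  have hpos : 0 < f (K1 L) := htm.2.2.1
  -- all bond products are nonnegative
  have hdef : ∑ s : Tor L, (|f s| * nbSum L (fun u => |f u|) s - f s * nbSum L f s) = 0 := by
    rw [← qf_sub_qf_abs, hQeq, sub_self]
  have hterm : ∀ s : Tor L, |f s| * nbSum L (fun u => |f u|) s - f s * nbSum L f s = 0 := fun s =>
    (Finset.sum_eq_zero_iff_of_nonneg (fun s _ => abs_nbSum_sub_nonneg L f s)).1 hdef s (Finset.mem_univ s)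
  have hbond : ∀ s : Tor L, 0 ≤ f s * f (s + ex L) ∧ 0 ≤ f s * f (s + ey L) := by
    intro s
    have h := hterm s
    unfold nbSum at h
    have h1 := le_abs_self (f s * f (s + ex L))
    have h2 := le_abs_self (f s * f (s + -ex L))
    have h3 := le_abs_self (f s * f (s + ey L))
    have h4 := le_abs_self (f s * f (s + -ey L))
    rw [abs_mul] at h1 h2 h3 h4
    have e1 : |f s| * |f (s + ex L)| = f s * f (s + ex L) := by linarith
    have e3 : |f s| * |f (s + ey L)| = f s * f (s + ey L) := by linarith
    constructor
    · rw [← e1]; positivity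
    · rw [← e3]; positivity
  -- positivity propagates
  have hx : ∀ s : Tor L, s ≠ 0 → 0 < f s → s + ex L ≠ 0 → 0 < f (s + ex L) := by
    intro s _ hfs hs'
    have hb := (hbond s).1
    have hnz := hne (s + ex L) hs'
    rcases lt_or_gt_of_ne hnz with hlt | hgt
    · nlinarith
    · exact hgt
  have hy : ∀ s : Tor L, s ≠ 0 → 0 < f s → s + ey L ≠ 0 → 0 < f (s + ey L) := by
    intro s _ hfs hs'
    have hb := (hbond s).2
    have hnz := hne (s + ey L) hs'
    rcases lt_or_gt_of_ne hnz with hlt | hgt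
    · nlinarith
    · exact hgt
  exact torus_connect L hL (fun s => 0 < f s) hx hy (K1_ne_zero L hL) hr hpos

end Summit.HubbardSuperconductivity.HubbardSuperconductivity.Theorems.AnisotropyChord.Transfer.Fibre3

end
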